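import Summits.ResolutionOfSingularities.ResolutionOfSingularities.Theorems.HilbertSamuelEliminationSigmaMaxModificationsCorridor3WLadderMovingTwoCensus2
import Summits.ResolutionOfSingularities.ResolutionOfSingularities.Theorems.HilbertSamuelEliminationSigmaMaxModificationsCorridor3WLadderSegmentsAssemblyBF
import Summits.ResolutionOfSingularities.ResolutionOfSingularities.Theorems.HilbertSamuelEliminationSigmaMaxModificationsCorridor3WLadderCharRowPrinted
import HarnessLib

/-!
# [OURS · L1 W4.2] CENSUS EDITION 6 OF THE β ROW `Wlow3TwoM` (p = 2, dim X = 3, any residue characteristic) AND OF THE CONJUNCT: the ONE OURS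
# CONSTRUCTION of editions 2–5 — unit recognition `Seg.UnitRecognitionAtQM 2 ⊤` — is DISCHARGED; the characteristic-free unit-tower extraction now
# comes from F-51′ / CJS 3.10 (4) by `Seg.unitTowerExtractionLocFreeM_of_geomDirFacts` (`…SegmentsAssemblyBF`, division (c′) of res-L1-w42-plan-1
# RULING v3.14-24 (GD)) (crux `SigmaMaxModifications` stmt-ResolutionOfSingularities-18506; conjunct `SigmaMaxModificationsCorridor3` stmt-…-19249;
# line `w_ladder`; row `stub_Wlow3M_two`)

Pool seat res-D-pv-038 (gen 8), next to res-L1-w42-stub-3's editions 2–5 (`…MovingTwoCensus2`) and res-L1-w42-stub-4's char-row census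
(`…CharRowPrinted`). Helper file `--supports stmt-ResolutionOfSingularities-19249 --as helper`; kernel only, no new definition. CONDITIONAL —
credits nothing: every binder is a printed named fact or an OURS CLAIM of record, and each statement is the honest residue as ONE checkable term.

* **`wlow3TwoM_census₆`** — `∀ p, p.Prime → Wlow3TwoM p` ⟸ exactly: PRINTED {[H4] Th. IV `Hironaka1970_thmIV` (F-51′), CJS Thm. 3.10 (4)
  `CossartJannsenSaito2020_thm_3_10_4`} + OURS CLAIMS R_β {`KeyTheorem640_localized_isolated`, `Corollary637_geomDir`} — and NO OURS construction
  (edition 5, `wlow3TwoM_census₅`, still bound `hrec : Seg.UnitRecognitionAtQM 2 ⊤`). The (F1♯) renderings of Thm. 3.14 (`Theorem314_geomDir`,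
  `Theorem314_nearFibre_geomDir`, `Thm314_point_locus_geomDir`), `ProjDir_line`, CJS Thm. 3.6, F-split are tree theorems plugged by name, as in
  editions 3–5.
* **`Residue.sigmaMaxModificationsCorridor3_of_printed_of_claims_of_two_rows`** — the conjunct `SigmaMaxModificationsCorridor3` ⟸ PRINTED {CJS ν-elimination
  `CossartJannsenSaito2020_nuElimination`, `CossartJannsenSaito2020SequencePermissible`, CJS Thm. 3.10 (4), [H4] Th. IV} + OURS CLAIMS R_β
  {`KeyTheorem640_localized_isolated`, `Corollary637_geomDir`} (the char-row claims follow from them) + TWO OURS ROWS {`Wtop3PointedM`, `Wtop3NonpointedM`}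
  (res-L1-w42-stub-4's `Residue.sigmaMaxModificationsCorridor3_of_printed_of_three_rows` with its `Wlow3TwoM` row supplied by `wlow3TwoM_census₆`).

OURS bookkeeping; NOT a statement of the manuscript [Hironaka2017] nor of [CossartJannsenSaito2020]. AI-written; AI review is weaker than expert
review.

References: V. Cossart, U. Jannsen, S. Saito, LNM 2270 (2020), Thm. 3.6, Thm. 3.10 (4), Thm. 3.14, Def. 6.34, Cor. 6.37, Def. 6.38, Thm. 6.40 [CossartJannsenSaito2020];
H. Hironaka, Certain numerical characters of singularities (1970), Th. IV [Hironaka1970NumericalCharacters].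
-/

noncomputable section

set_option linter.dupNamespace false -- namespace `…Corridor3.Moving` re-enters `…Corridor3` (module convention of the Moving files)

open CategoryTheory AlgebraicGeometry TopologicalSpace Topology IsLocalRing
open Summit.ResolutionOfSingularities.ResolutionOfSingularities.Theorems.CampaignW42
open Literature.AlgebraicGeometry.Resolution Literature.RingTheory.HilbertSamuel
open Literature.AlgebraicGeometry.CossartJannsenSaito2020
open Summit.ResolutionOfSingularities.ResolutionOfSingularities.Theses.HilbertSamuelElimination
open Summit.ResolutionOfSingularities.ResolutionOfSingularities.Theorems.SigmaMaxModificationsCorridor3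

namespace Summit.ResolutionOfSingularities.ResolutionOfSingularities.Theorems.SigmaMaxModificationsCorridor3.Moving

/-- **CENSUS EDITION 6 OF THE β ROW: `∀ p, p.Prime → Wlow3TwoM p` from [H4] Th. IV, CJS Thm. 3.10 (4) and the two R_β OURS CLAIMS — no OURS
construction.** Edition 5 (`wlow3TwoM_census₅`, res-L1-w42-stub-3) with the unit recognition `hrec : Seg.UnitRecognitionAtQM 2 ⊤` REPLACED by the
theorem `Seg.unitTowerExtractionLocFreeM_of_geomDirFacts` (res-D-pv-038, `…SegmentsAssemblyBF`), whose binders are discharged by name: `Theorem314_geomDir`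
(`Directrix214Sharp.theorem314_geomDir_of_thmIV_of_split` + `HerrmannIkedaOrbanz1988_cor_21_11_holds`), `Theorem314_nearFibre_geomDir`
(`theorem314_nearFibre_geomDir_of_thmIV`), `Thm314_point_locus_geomDir` (`Directrix214Sharp.thm314_point_locus_geomDir_of_thmIV_point` ∘
`Hironaka1970_thmIV_point_of_thmIV`), CJS Thm. 3.6 (`CossartJannsenSaito2020_thm_3_6_holds`); bridge and strata halves as in editions 2–5.
CONDITIONAL — credits nothing. [cite: CossartJannsenSaito2020, Thm. 3.10 (4), Thm. 3.14, Def. 6.34, Thm. 6.35, Cor. 6.37, Def. 6.38, Thm. 6.40]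
[cite: Hironaka1970NumericalCharacters, Th. IV] -/
theorem wlow3TwoM_census₆
    (h51 : Hironaka1970_thmIV.{0}) (h3104 : CossartJannsenSaito2020_thm_3_10_4.{0})
    (hK : KeyTheorem640_localized_isolated.{0}) (hC : Corollary637_geomDir.{0}) :
    ∀ p : ℕ, p.Prime → Wlow3TwoM.{0} p :=
  have hF314 : Theorem314_geomDir.{0} :=
    Directrix214Sharp.theorem314_geomDir_of_thmIV_of_split h51 HerrmannIkedaOrbanz1988_cor_21_11_holds
  have h314gd : Thm314_point_locus_geomDir.{0} :=
    Directrix214Sharp.thm314_point_locus_geomDir_of_thmIV_point (Hironaka1970_thmIV_point_of_thmIV h51)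
  wlow3TwoM_of_residue_loc hK hC hF314 (isoE1BridgeFreeM_of_facts hF314 h3104 h314gd projDir_line 2)
    (Seg.unitTowerExtractionLocFreeM_of_geomDirFacts 2 hF314 (theorem314_nearFibre_geomDir_of_thmIV h51) h314gd
      CossartJannsenSaito2020_thm_3_6_holds h3104)
    (wlowStrataM_of_thmIV_of_claims h51 h3104 hK hC)

end Summit.ResolutionOfSingularities.ResolutionOfSingularities.Theorems.SigmaMaxModificationsCorridor3.Moving

namespace Summit.ResolutionOfSingularities.ResolutionOfSingularities.Theorems.SigmaMaxModificationsCorridor3.Residue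

open Summit.ResolutionOfSingularities.ResolutionOfSingularities.Theorems.SigmaMaxModificationsCorridor3.Moving

/-- **CENSUS OF THE CONJUNCT `SigmaMaxModificationsCorridor3` (2026-08-27, after (c′)): FOUR PRINTED FACTS + THE TWO R_β OURS CLAIMS + TWO OURS
ROWS.** ⟸ PRINTED {CJS ν-elimination `CossartJannsenSaito2020_nuElimination`, `CossartJannsenSaito2020SequencePermissible`, CJS Thm. 3.10 (4)
`CossartJannsenSaito2020_thm_3_10_4`, [H4] Th. IV `Hironaka1970_thmIV`} + OURS CLAIMS R_β {`KeyTheorem640_localized_isolated`, `Corollary637_geomDir`}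
(the char row's `KeyTheorem640_char_localized_isolated` / `Corollary637_char` FOLLOW from them: `keyTheorem640_char_localized_isolated_of_free`,
`corollary637_char_of_geomDir`) + OURS ROWS {`Wtop3PointedM`, `Wtop3NonpointedM`} — res-L1-w42-stub-4's
`sigmaMaxModificationsCorridor3_of_printed_of_three_rows` with the row `Wlow3TwoM` supplied by `Moving.wlow3TwoM_census₆`. CONDITIONAL — credits
nothing; the conjunct's honest residue as ONE checkable statement. [cite: CossartJannsenSaito2020, Thm. 3.10 (4), Thm. 5.17, Cor. 6.37, Thm. 6.40]
[cite: Hironaka1970NumericalCharacters, Th. IV] -/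
theorem sigmaMaxModificationsCorridor3_of_printed_of_claims_of_two_rows
    (hNu : CossartJannsenSaito2020_nuElimination.{0}) (hSeq : CossartJannsenSaito2020SequencePermissible.{0})
    (h310 : CossartJannsenSaito2020_thm_3_10_4.{0}) (h51 : Hironaka1970_thmIV.{0})
    (hK : KeyTheorem640_localized_isolated.{0}) (hC : Corollary637_geomDir.{0})
    (hTopP : ∀ p : ℕ, p.Prime → Wtop3PointedM.{0} p) (hTopN : ∀ p : ℕ, p.Prime → Wtop3NonpointedM.{0} p) :
    SigmaMaxModificationsCorridor3 :=
  sigmaMaxModificationsCorridor3_of_printed_of_three_rows hNu hSeq h310 (keyTheorem640_char_localized_isolated_of_free hK)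
    (corollary637_char_of_geomDir hC) h51 (wlow3TwoM_census₆ h51 h310 hK hC) hTopP hTopN

end Summit.ResolutionOfSingularities.ResolutionOfSingularities.Theorems.SigmaMaxModificationsCorridor3.Residue

end
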